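import Summits.KontsevichZagierPeriods.Zeta5Search.TwoTaleOmega.StepBR
import Summits.KontsevichZagierPeriods.Zeta5Search.TwoTaleOmega.OmegaBridge

/-!
# (bmiss)@Ω — the recurrence in direction `b` for the sign-free forms `U1`, `U0` (cell `pub-zeta5`, cert-1 gen 4)

HONEST FRAMING: systematic search; recurrence certificates; no irrationality claim unless certified. Pure finite algebra
over `ℚ`; no named fact, no `sorry`.

Blueprint `families/tele/RECURRENCE.md` §13.10–13.12, direction `δ = b = (0,1,0,0,0)`. Combining the first-tale
(`StepBL.recL_b`) and second-tale (`StepBR.recR_b`) recurrences — which hold with the SAME telescoper `c^b_k(p)` of cert-2's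
kernel identities `telescope_b_L/R` — gives the recurrence of the sign-free functional forms of `OmegaForms`:
  `Σ_{k<4} c^b_k(p) · U1(p + kδ_b) = 0`,  `Σ_{k<4} c^b_k(p) · U0(p + kδ_b) = 0`
for every base point `p` with `p, p+δ, p+2δ, p+3δ ∈ Ω` (`rec_b`); since `c^b_3(p) = 2e+2f+b+1−a−g ≥ 2` on Ω, the values at
`p+3δ` are determined by those at `p, p+δ, p+2δ` (`step_b`), which is the `b`-step of the Ω-induction for (bmiss)
(`OmegaForms.bmiss_iff`, `hP_of_U`). The first-tale truncations `dExp(p+kδ)` of `U0` are aligned by `lam0_eq_of_le`.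
-/

noncomputable section

open Finset Polynomial
open Literature.NumberTheory.Irrationality.Zudilin2014
open Summit.KontsevichZagierPeriods.Zeta5Search.FormalBarnes
open Summit.KontsevichZagierPeriods.Zeta5Search.Certificates.TwoTaleTelescope

namespace Summit.KontsevichZagierPeriods.Zeta5Search.TwoTaleOmega

namespace Pt

variable {p : Pt}

/-- The first-tale truncation of `U0` may be raised to the common `d⁺(p) + 7` along `δ_b`. -/
theorem lam0_dExp_eq (h0 : p.Omega) {k : ℤ} (hk : (p.addB k).Omega) (hk0 : 0 ≤ k) (hk3 : k ≤ 3) (s : ℤ) :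
    lam0 (dExp (p.addB k).t1a (p.addB k).t1b) s (p.addB k).vL = lam0 (dExp p.t1a p.t1b + 7) s (p.addB k).vL := by
  refine (lam0_eq_of_le s _ (vL_natDegree_le_w hk) ?_).symm
  unfold dExp
  rw [sum_t1a_sub_sum_t1b, sum_t1a_sub_sum_t1b, dInt_addB]
  have := h0.g_le; unfold dInt; omega

/-- **The `b`-recurrence of the sign-free forms.** For `p, p+δ_b, p+2δ_b, p+3δ_b ∈ Ω`:
`Σ_k c^b_k(p)·U1(p+kδ_b) = 0` and `Σ_k c^b_k(p)·U0(p+kδ_b) = 0`. -/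
theorem rec_b (h0 : p.Omega) (h1 : (p.addB 1).Omega) (h2 : (p.addB 2).Omega) (h3 : (p.addB 3).Omega) :
    (p.coefB 0 * p.U1 + p.coefB 1 * (p.addB 1).U1 + p.coefB 2 * (p.addB 2).U1 + p.coefB 3 * (p.addB 3).U1 = 0) ∧
    (p.coefB 0 * p.U0 + p.coefB 1 * (p.addB 1).U0 + p.coefB 2 * (p.addB 2).U0 + p.coefB 3 * (p.addB 3).U0 = 0) := by
  have hL := recL_b h0 h1 h2 h3
  have hR := recR_b h0 h1 h2 h3
  have e0 := lam0_dExp_eq h0 (k := 0) (by rw [addB_zero]; exact h0) le_rfl (by norm_num) p.nodeL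
  rw [addB_zero] at e0
  have e1 := lam0_dExp_eq h0 h1 (by norm_num) (by norm_num) (p.addB 1).nodeL
  have e2 := lam0_dExp_eq h0 h2 (by norm_num) (by norm_num) (p.addB 2).nodeL
  have e3 := lam0_dExp_eq h0 h3 (by norm_num) (by norm_num) (p.addB 3).nodeL
  unfold U1 U0
  rw [e0, e1, e2, e3]
  constructor
  · linear_combination hL.1 + (1 / 4 : ℚ) * hR.1
  · linear_combination hL.2 + (1 / 2 : ℚ) * hR.2

/-- **The `b`-step of the Ω-induction**: if `U1`, `U0` vanish at `p, p+δ_b, p+2δ_b` (all four points in Ω), they vanish at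
`p+3δ_b` — the leading coefficient `c^b_3(p) ≥ 2` is non-zero. -/
theorem step_b (h0 : p.Omega) (h1 : (p.addB 1).Omega) (h2 : (p.addB 2).Omega) (h3 : (p.addB 3).Omega)
    (u0 : p.U1 = 0 ∧ p.U0 = 0) (u1 : (p.addB 1).U1 = 0 ∧ (p.addB 1).U0 = 0)
    (u2 : (p.addB 2).U1 = 0 ∧ (p.addB 2).U0 = 0) : (p.addB 3).U1 = 0 ∧ (p.addB 3).U0 = 0 := by
  have hc : p.coefB 3 ≠ 0 := by have := coefB_three_pos h0; positivity
  have h := rec_b h0 h1 h2 h3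
  rw [u0.1, u1.1, u2.1, u0.2, u1.2, u2.2] at h
  simp only [mul_zero, zero_add] at h
  exact ⟨(mul_eq_zero.1 h.1).resolve_left hc, (mul_eq_zero.1 h.2).resolve_left hc⟩

/-- The same step in DESCENDING form (as used by a rule that selects `δ_b` at the target `q`: base point `q − 3δ_b`). -/
theorem step_b_desc {q : Pt} (h0 : (q.addB (-3)).Omega) (h1 : (q.addB (-2)).Omega) (h2 : (q.addB (-1)).Omega)
    (h3 : q.Omega) (u0 : (q.addB (-3)).U1 = 0 ∧ (q.addB (-3)).U0 = 0)
    (u1 : (q.addB (-2)).U1 = 0 ∧ (q.addB (-2)).U0 = 0) (u2 : (q.addB (-1)).U1 = 0 ∧ (q.addB (-1)).U0 = 0) :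
    q.U1 = 0 ∧ q.U0 = 0 := by
  have e1 : (q.addB (-3)).addB 1 = q.addB (-2) := by rw [addB_addB]; norm_num
  have e2 : (q.addB (-3)).addB 2 = q.addB (-1) := by rw [addB_addB]; norm_num
  have e3 : (q.addB (-3)).addB 3 = q := by rw [addB_addB]; norm_num; exact addB_zero q
  have := step_b (p := q.addB (-3)) h0 (by rw [e1]; exact h1) (by rw [e2]; exact h2) (by rw [e3]; exact h3) u0
    (by rw [e1]; exact u1) (by rw [e2]; exact u2)
  rwa [e3] at this

end Pt

/-! ### The `δ = dirB` case of cert-2's step hypotheses `hL`/`hR` (`TwoTaleOmegaAefTable.eq_on_Omega_all`) -/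

/-- **Plug-in form for cert-2's Ω-induction, `U1`:** for every base point `p₀` of a step in direction `dirB` (any legitimacy
predicate), `Σ_{k<4} coef(dirB,p₀,k) · U1(p₀ + k·dirB) = 0`. -/
theorem hstep_b_U1 (cAEF : Certificates.TwoTaleTelescope.Pt → ℕ → ℤ) (Legit : Certificates.TwoTaleTelescope.Pt →
    Certificates.TwoTaleTelescope.Pt → Prop) (p₀ : Certificates.TwoTaleTelescope.Pt) (h : p₀ ∈ StepBase Legit dirB) :
    ∑ k ∈ range 4, (coef cAEF dirB p₀ k : ℚ) * (ofVec (p₀ + (k : ℤ) • dirB)).U1 = 0 := by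
  have hΩ := h.2.1
  have h0 : (ofVec p₀).Omega := by have := Omega_ofVec (hΩ 0 (by norm_num)); simpa using this
  have h1 : ((ofVec p₀).addB 1).Omega := by rw [← ofVec_add_dirB]; exact Omega_ofVec (by simpa using hΩ 1 (by norm_num))
  have h2 : ((ofVec p₀).addB 2).Omega := by rw [← ofVec_add_dirB]; exact Omega_ofVec (by simpa using hΩ 2 (by norm_num))
  have h3 : ((ofVec p₀).addB 3).Omega := by rw [← ofVec_add_dirB]; exact Omega_ofVec (by simpa using hΩ 3 (by norm_num))
  have r := (Pt.rec_b h0 h1 h2 h3).1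
  rw [sum_range_succ, sum_range_succ, sum_range_succ, sum_range_one]
  simp only [coef_B, tabAt_cast, tabB]
  push_cast
  simp only [ofVec_add_dirB, Pt.addB_zero]
  simpa [Pt.coefB] using r

/-- **Plug-in form for cert-2's Ω-induction, `U0`.** -/
theorem hstep_b_U0 (cAEF : Certificates.TwoTaleTelescope.Pt → ℕ → ℤ) (Legit : Certificates.TwoTaleTelescope.Pt →
    Certificates.TwoTaleTelescope.Pt → Prop) (p₀ : Certificates.TwoTaleTelescope.Pt) (h : p₀ ∈ StepBase Legit dirB) :
    ∑ k ∈ range 4, (coef cAEF dirB p₀ k : ℚ) * (ofVec (p₀ + (k : ℤ) • dirB)).U0 = 0 := by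
  have hΩ := h.2.1
  have h0 : (ofVec p₀).Omega := by have := Omega_ofVec (hΩ 0 (by norm_num)); simpa using this
  have h1 : ((ofVec p₀).addB 1).Omega := by rw [← ofVec_add_dirB]; exact Omega_ofVec (by simpa using hΩ 1 (by norm_num))
  have h2 : ((ofVec p₀).addB 2).Omega := by rw [← ofVec_add_dirB]; exact Omega_ofVec (by simpa using hΩ 2 (by norm_num))
  have h3 : ((ofVec p₀).addB 3).Omega := by rw [← ofVec_add_dirB]; exact Omega_ofVec (by simpa using hΩ 3 (by norm_num))
  have r := (Pt.rec_b h0 h1 h2 h3).2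
  rw [sum_range_succ, sum_range_succ, sum_range_succ, sum_range_one]
  simp only [coef_B, tabAt_cast, tabB]
  push_cast
  simp only [ofVec_add_dirB, Pt.addB_zero]
  simpa [Pt.coefB] using r

end Summit.KontsevichZagierPeriods.Zeta5Search.TwoTaleOmega

end
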